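import Summits.KontsevichZagierPeriods.KontsevichZagierPeriods.Theses.HurwitzMicroSectors
import Summits.KontsevichZagierPeriods.KontsevichZagierPeriods.Theorems.HurwitzMicroSectorsNormalFormPrinciplePiBoxTransfer

/-! TTRL-lite variant V2214 of stmt-KontsevichZagierPeriods-3869

Variant V2214 = `stub_boxRigidity` (the leaf `BoxRigidity` of `NormalFormPrinciple`: two BOX-RATIONAL
representations — domain the open unit box, integrand `p/q` over `ℚ` — with equal values are
KZ-equivalent) under the move `drop_hyp:2`: the hypothesis `N'.domain = box` is dropped, so `N` is
box-rational but `N'` is an ARBITRARY representation of KZ's rational shape (any `ℚ`-semialgebraic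
domain, any dimension). Verdict of the attempt seat: **open, and provably EXACTLY the Summit** — this
file is the exact-strength certificate, not a proof of the variant:

* `stub_boxRigidity_var2214_iff_statement : V2214 ↔ KontsevichZagierPeriods` (Conjecture 1 for the
  tree's calculus), and `stub_boxRigidity_var2214_iff_kzKernelConjecture : V2214 ↔ KZKernelConjecture`.
  (⇐) V2214 is a special case of the two-representation form. (⇒) the free side `N'` may be ANY
  rational representation, so comparing a rational representation `r` of value `0` with the zero
  representation on the `0`-box (box-rational, value `0`, itself a relation) gives
  `RationalVanishing` — every rational-shape representation of value `0` is a relation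
  (`rationalVanishing_of_stub_boxRigidity_var2214`); and `RationalVanishing ⇒ KZKernelConjecture`
  (`kzKernelConjecture_of_rationalVanishing`) by three tree facts: a formal combination is
  `≡ [r] − [r']` (`exists_integralRep_sub`), `[r] + [r'.neg] ≡ [R]` for ONE representation `R`
  (`IntegralRep.exists_of_add_of_sub_of_mem_relations`: slabs at disjoint levels, domain additivity),
  and `R ∼ Q` with `Q` of rational shape (`exists_isRational_equivalent`, KZ §1.1 remark); `Q` has
  value `0` by soundness. Hence also `rationalVanishing_iff_statement`.
* Relative to the parent: `stub_boxRigidity_var2214_iff_parent_and_piCancellation :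
  V2214 ↔ BoxRigidity ∧ KZ.PiCancellation` (by `statement_iff_leaves` of file `…PiBoxTransfer`): dropping
  `N'.domain = box` adds to the leaf exactly the other leaf `PiCancellation` (`[π]` a non-zero-divisor
  modulo relations, item stmt-KontsevichZagierPeriods-0540) — the geometry that `PiBoxReduction`
  removes only up to a power of `[π]`.
* The mirrored move `drop_hyp:0` (drop `N.domain = box` instead) is the same statement by symmetry of
  `Equivalent` (`stub_boxRigidity_var2214_iff_mirror`), hence also exactly the Summit.
* Consequences recorded: `V2214 ⇒ parent`, `⇒ KZ.PiCancellation`, `⇒ KZ.PiLocalKernel`.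

No proof or refutation is possible here: a proof of V2214 proves the Summit (the Kontsevich–Zagier
period conjecture for the calculus of `KZCalculus.lean`, open — Huber–Wüstholz 2022, Prologue;
Cresson–Viu-Sos 2022, §1), a refutation refutes it. Residual goal: the Summit itself.
Source: M. Kontsevich, D. Zagier, *Periods* (2001), §1.1 (remark after the Definition), §1.2
(Conjecture 1, rules 1)–3)). Pure proof file, no definitions. -/

-- `Summit.<Summit>.<Problem>` is the tree's mandated summit-side namespace (CONVENTIONS §2); for this
-- single-conjunct summit the two coincide, so the duplicate is deliberate.
set_option linter.dupNamespace false

noncomputable section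

namespace Summit.KontsevichZagierPeriods.KontsevichZagierPeriods.Theorems

open MeasureTheory Set
open Literature.NumberTheory.Transcendental Literature.NumberTheory.Transcendental.KZ
open Summit.KontsevichZagierPeriods.KontsevichZagierPeriods.Theses.HurwitzMicroSectors
open Summit.KontsevichZagierPeriods.HurwitzMicroSectors.NormalFormPrinciple.PiBox

/-! ## `RationalVanishing ⇒ KZKernelConjecture` (tree bookkeeping) -/

/-- **Vanishing of single rational-shape representations gives the kernel conjecture.** If every
representation of KZ's rational shape with value `0` is a relation, then every formal combination of
value `0` is a relation: `c ≡ [r] − [r'] ≡ [r] + [r'.neg] ≡ [R] ≡ [Q]` with `Q` of rational shape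
(`exists_integralRep_sub`, `IntegralRep.exists_of_add_of_sub_of_mem_relations`,
`exists_isRational_equivalent`), and `Q.value = eval c = 0` by soundness.
[cite: KontsevichZagier2001, §1.2 Conjecture 1] -/
theorem kzKernelConjecture_of_rationalVanishing
    (hvan : ∀ (n : ℕ) (r : IntegralRep n), r.IsRational → r.value = 0 → of r ∈ relations) :
    KZKernelConjecture := by
  intro c hc
  obtain ⟨n, m, r, r', hrel⟩ := exists_integralRep_sub_holds c
  obtain ⟨k, R, hR⟩ := IntegralRep.exists_of_add_of_sub_of_mem_relations r r'.neg
  have hneg : of r' + of r'.neg ∈ relations :=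
    of_add_of_mem_relations_of_eqOn_neg rfl fun x _ => rfl
  obtain ⟨l, Q, hQr, hRQ⟩ := exists_isRational_equivalent_holds R
  have hcQ : c - of Q ∈ relations := by
    have e : c - of Q = (c - (of r - of r')) + (of r + of r'.neg - of R) - (of r' + of r'.neg) +
        (of R - of Q) := by abel
    rw [e]
    exact relations.add_mem (relations.sub_mem (relations.add_mem hrel hR) hneg) hRQ
  have hQv : Q.value = 0 := by
    have e := relations_le_ker_eval_holds hcQ
    rw [AddMonoidHom.mem_ker, map_sub, eval_of, hc, zero_sub, neg_eq_zero] at e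
    exact e
  have := relations.add_mem hcQ (hvan l Q hQr hQv)
  rwa [sub_add_cancel] at this

/-- **`RationalVanishing ⟺ KontsevichZagierPeriods`**: the single-representation vanishing form of
Conjecture 1 (a rational-shape representation of value `0` is a relation) is equivalent to the Summit
— (⇒) through the kernel form (`kzKernelConjecture_of_rationalVanishing`,
`kzKernelConjecture_iff_isRational`); (⇐) compare with the zero representation on the `0`-box.
[cite: KontsevichZagier2001, §1.2 Conjecture 1] -/
theorem rationalVanishing_iff_statement :
    (∀ (n : ℕ) (r : IntegralRep n), r.IsRational → r.value = 0 → of r ∈ relations) ↔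
    _root_.KontsevichZagierPeriods := by
  refine ⟨fun hvan => KontsevichZagierPeriods_iff.2
      (kzKernelConjecture_iff_isRational.1 (kzKernelConjecture_of_rationalVanishing hvan)),
    fun h n r hr hv => ?_⟩
  obtain ⟨Z, hZd, hZi⟩ := exists_zeroRep (isSemialgebraic_box 0)
  have hZ : of Z ∈ relations := of_mem_relations_of_eqOn_zero Z (by simp [hZi, EqOn])
  have hZv : Z.value = 0 := by simp [IntegralRep.value, hZi]
  have hZr : Z.IsRational := ⟨0, 1, fun x _ => by simp, fun x _ => by simp [hZi]⟩
  have hZr' : of Z - of r ∈ relations := KontsevichZagierPeriods_iff.1 h Z r hZr hr (by rw [hZv, hv])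
  have := relations.sub_mem hZ hZr'
  rwa [sub_sub_cancel] at this

/-! ## The variant V2214 is exactly the Summit -/

/-- **V2214 ⇒ `RationalVanishing`**: the free side `N'` of the variant may be ANY rational-shape
representation, so a rational representation `r` of value `0` is KZ-equivalent to the zero
representation on the `0`-box (box-rational, value `0`, itself a relation), hence a relation.
[cite: KontsevichZagier2001, §1.2 Conjecture 1] -/
theorem rationalVanishing_of_stub_boxRigidity_var2214
    (h : ∀ (m m' : ℕ) (N : IntegralRep m) (N' : IntegralRep m'), N.domain = {x | ∀ i, x i ∈ Set.Ioo (0:ℝ) 1} → N.IsRational → N'.IsRational → N.value = N'.value → Equivalent N N')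
    (n : ℕ) (r : IntegralRep n) (hr : r.IsRational) (hv : r.value = 0) : of r ∈ relations := by
  obtain ⟨Z, hZd, hZi⟩ := exists_zeroRep (isSemialgebraic_box 0)
  have hZ : of Z ∈ relations := of_mem_relations_of_eqOn_zero Z (by simp [hZi, EqOn])
  have hZv : Z.value = 0 := by simp [IntegralRep.value, hZi]
  have hZr : Z.IsRational := ⟨0, 1, fun x _ => by simp, fun x _ => by simp [hZi]⟩
  have hZr' : of Z - of r ∈ relations := h 0 n Z r hZd hZr hr (by rw [hZv, hv])
  have := relations.sub_mem hZ hZr'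
  rwa [sub_sub_cancel] at this

/-- **V2214 ⇒ `KZKernelConjecture`** (the kernel form of Conjecture 1 for the tree's calculus).
[cite: KontsevichZagier2001, §1.2 Conjecture 1] -/
theorem kzKernelConjecture_of_stub_boxRigidity_var2214
    (h : ∀ (m m' : ℕ) (N : IntegralRep m) (N' : IntegralRep m'), N.domain = {x | ∀ i, x i ∈ Set.Ioo (0:ℝ) 1} → N.IsRational → N'.IsRational → N.value = N'.value → Equivalent N N') :
    KZKernelConjecture :=
  kzKernelConjecture_of_rationalVanishing (rationalVanishing_of_stub_boxRigidity_var2214 h)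

/-- **V2214 ⇒ the Summit** `KontsevichZagierPeriods`. [cite: KontsevichZagier2001, §1.2 Conjecture 1] -/
theorem statement_of_stub_boxRigidity_var2214
    (h : ∀ (m m' : ℕ) (N : IntegralRep m) (N' : IntegralRep m'), N.domain = {x | ∀ i, x i ∈ Set.Ioo (0:ℝ) 1} → N.IsRational → N'.IsRational → N.value = N'.value → Equivalent N N') :
    _root_.KontsevichZagierPeriods :=
  KontsevichZagierPeriods_iff.2
    (kzKernelConjecture_iff_isRational.1 (kzKernelConjecture_of_stub_boxRigidity_var2214 h))

/-- **The Summit ⇒ V2214**: the variant is a special case of the two-representation form of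
Conjecture 1 (box-rational representations have rational shape). [cite: KontsevichZagier2001, §1.2 Conjecture 1] -/
theorem stub_boxRigidity_var2214_of_statement (h : _root_.KontsevichZagierPeriods) :
    ∀ (m m' : ℕ) (N : IntegralRep m) (N' : IntegralRep m'), N.domain = {x | ∀ i, x i ∈ Set.Ioo (0:ℝ) 1} → N.IsRational → N'.IsRational → N.value = N'.value → Equivalent N N' :=
  fun _ _ N N' _ hNr hN'r hv => KontsevichZagierPeriods_iff.1 h N N' hNr hN'r hv

/-- **Exact strength: `V2214 ⟺ KontsevichZagierPeriods`.** Dropping `N'.domain = box` from the leaf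
`BoxRigidity` gives back the whole Kontsevich–Zagier period conjecture for the tree's calculus; the
variant is open exactly as the Summit is. [cite: KontsevichZagier2001, §1.2 Conjecture 1] -/
theorem stub_boxRigidity_var2214_iff_statement :
    (∀ (m m' : ℕ) (N : IntegralRep m) (N' : IntegralRep m'), N.domain = {x | ∀ i, x i ∈ Set.Ioo (0:ℝ) 1} → N.IsRational → N'.IsRational → N.value = N'.value → Equivalent N N') ↔
    _root_.KontsevichZagierPeriods :=
  ⟨statement_of_stub_boxRigidity_var2214, stub_boxRigidity_var2214_of_statement⟩

/-- **`V2214 ⟺ KZKernelConjecture`** (`ker eval = relations`). [cite: KontsevichZagier2001, §1.2 Conjecture 1] -/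
theorem stub_boxRigidity_var2214_iff_kzKernelConjecture :
    (∀ (m m' : ℕ) (N : IntegralRep m) (N' : IntegralRep m'), N.domain = {x | ∀ i, x i ∈ Set.Ioo (0:ℝ) 1} → N.IsRational → N'.IsRational → N.value = N'.value → Equivalent N N') ↔
    KZKernelConjecture :=
  ⟨kzKernelConjecture_of_stub_boxRigidity_var2214,
    fun h => stub_boxRigidity_var2214_of_statement
      (KontsevichZagierPeriods_iff.2 (kzKernelConjecture_iff_isRational.1 h))⟩

/-! ## Relative to the parent leaf and the sibling moves -/

/-- **V2214 ⇒ the parent leaf `BoxRigidity`** (re-insert the dropped hypothesis).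
[cite: KontsevichZagier2001, §1.2 Conjecture 1] -/
theorem stub_boxRigidity_parent_of_var2214
    (h : ∀ (m m' : ℕ) (N : IntegralRep m) (N' : IntegralRep m'), N.domain = {x | ∀ i, x i ∈ Set.Ioo (0:ℝ) 1} → N.IsRational → N'.IsRational → N.value = N'.value → Equivalent N N') :
    ∀ (m m' : ℕ) (N : IntegralRep m) (N' : IntegralRep m'), N.domain = {x | ∀ i, x i ∈ Set.Ioo (0:ℝ) 1} → N.IsRational → N'.domain = {x | ∀ i, x i ∈ Set.Ioo (0:ℝ) 1} → N'.IsRational → N.value = N'.value → Equivalent N N' :=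
  fun m m' N N' hNd hNr _ hN'r hv => h m m' N N' hNd hNr hN'r hv

/-- **V2214 ⇒ `KZ.PiCancellation`** (through the Summit and `leaves_of_statement`).
[cite: KontsevichZagier2001, §4.1] -/
theorem piCancellation_of_stub_boxRigidity_var2214
    (h : ∀ (m m' : ℕ) (N : IntegralRep m) (N' : IntegralRep m'), N.domain = {x | ∀ i, x i ∈ Set.Ioo (0:ℝ) 1} → N.IsRational → N'.IsRational → N.value = N'.value → Equivalent N N') :
    PiCancellation :=
  (leaves_of_statement (statement_of_stub_boxRigidity_var2214 h)).2

/-- **V2214 ⇒ `KZ.PiLocalKernel`** (Ayoub's localised kernel conjecture for this calculus, through the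
parent leaf). [cite: Ayoub2014, Def. 6 and Conj. 7] -/
theorem piLocalKernel_of_stub_boxRigidity_var2214
    (h : ∀ (m m' : ℕ) (N : IntegralRep m) (N' : IntegralRep m'), N.domain = {x | ∀ i, x i ∈ Set.Ioo (0:ℝ) 1} → N.IsRational → N'.IsRational → N.value = N'.value → Equivalent N N') :
    PiLocalKernel :=
  piLocalKernel_of_boxRigidity (stub_boxRigidity_parent_of_var2214 h)

/-- **Exact strength relative to the parent: `V2214 ⟺ BoxRigidity ∧ PiCancellation`.** Dropping the
hypothesis `N'.domain = box` adds to the leaf exactly the line's other leaf (`statement_iff_leaves`).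
[cite: KontsevichZagier2001, §1.2 Conjecture 1] -/
theorem stub_boxRigidity_var2214_iff_parent_and_piCancellation :
    (∀ (m m' : ℕ) (N : IntegralRep m) (N' : IntegralRep m'), N.domain = {x | ∀ i, x i ∈ Set.Ioo (0:ℝ) 1} → N.IsRational → N'.IsRational → N.value = N'.value → Equivalent N N') ↔
    ((∀ (m m' : ℕ) (N : IntegralRep m) (N' : IntegralRep m'), N.domain = {x | ∀ i, x i ∈ Set.Ioo (0:ℝ) 1} → N.IsRational → N'.domain = {x | ∀ i, x i ∈ Set.Ioo (0:ℝ) 1} → N'.IsRational → N.value = N'.value → Equivalent N N') ∧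
      PiCancellation) :=
  ⟨fun h => ⟨stub_boxRigidity_parent_of_var2214 h, piCancellation_of_stub_boxRigidity_var2214 h⟩,
    fun h => stub_boxRigidity_var2214_of_statement (statement_of_leaves h.1 h.2)⟩

/-- **V2214 ⟺ its mirror `drop_hyp:0`** (drop `N.domain = box` instead: `N` any rational-shape
representation, `N'` box-rational), by symmetry of `Equivalent`; so the mirrored variant is exactly
the Summit as well. [cite: KontsevichZagier2001, §1.2 Conjecture 1] -/
theorem stub_boxRigidity_var2214_iff_mirror :
    (∀ (m m' : ℕ) (N : IntegralRep m) (N' : IntegralRep m'), N.domain = {x | ∀ i, x i ∈ Set.Ioo (0:ℝ) 1} → N.IsRational → N'.IsRational → N.value = N'.value → Equivalent N N') ↔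
    (∀ (m m' : ℕ) (N : IntegralRep m) (N' : IntegralRep m'), N.IsRational → N'.domain = {x | ∀ i, x i ∈ Set.Ioo (0:ℝ) 1} → N'.IsRational → N.value = N'.value → Equivalent N N') :=
  ⟨fun h m m' N N' hNr hN'd hN'r hv => (h m' m N' N hN'd hN'r hNr hv.symm).symm,
    fun h m m' N N' hNd hNr hN'r hv => (h m' m N' N hN'r hNd hNr hv.symm).symm⟩

/-- **The mirror `drop_hyp:0` ⟺ the Summit.** [cite: KontsevichZagier2001, §1.2 Conjecture 1] -/
theorem stub_boxRigidity_dropLeft_iff_statement :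
    (∀ (m m' : ℕ) (N : IntegralRep m) (N' : IntegralRep m'), N.IsRational → N'.domain = {x | ∀ i, x i ∈ Set.Ioo (0:ℝ) 1} → N'.IsRational → N.value = N'.value → Equivalent N N') ↔
    _root_.KontsevichZagierPeriods :=
  stub_boxRigidity_var2214_iff_mirror.symm.trans stub_boxRigidity_var2214_iff_statement

end Summit.KontsevichZagierPeriods.KontsevichZagierPeriods.Theorems

end
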